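import Summits.Ventures.LatticeQCDFlow.Exactness.IMHRejectionCurve
import HarnessLib

/-!
# The rejection curve is continuous with right derivative `λ'(u⁺) = Π(u)/u²`

HONEST FRAMING: exact (Metropolis-corrected) sampling algorithms for lattice gauge theory;
figures of merit are autocorrelation/cost numbers at stated couplings and volumes; no
continuum-physics claim.  (SCALAR calibration rung S0-A: not a gauge result.)

Venture `LatticeQCDFlow` (cell pub-lqcd), topic `Exactness`; FANOUT row 2 (`s0-phi4`, FLOW arm).
NEW WORK of the cell, second leg of the Smith–Tierney kernel (see `IMHRejectionCurve.lean`).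
Nothing is cited as a fact.

## What is proved (`u > 0`)

* `continuousAt_rejCurve`, `continuousOn_rejCurve` (dominated convergence);
* `tendsto_massBelow_right` — `Π(t⁻) → Π(u)` as `t ↓ u`;
* `intervalIntegrable_massBelow_div`;
* **`hasDerivWithinAt_rejCurve`** — `λ` has RIGHT derivative `Π(u)/u²` at every `u > 0` (at atoms
  of the weight law `λ` has a corner; the right derivative always exists), from the integral
  representation `λ(t) = λ(c) + ∫_c^t Π(x⁻)/x² dx` and the right limit of `Π(·⁻)`;
* `hasDerivWithinAt_rejCurve_pow`, `hasDerivWithinAt_rejCurve_pow_div` — right derivatives of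
  `λ^{n+1}` and `λ^{n+1}/u`, the two integrands of the Smith–Tierney recursion.
-/

namespace Summit.Ventures.LatticeQCDFlow.Exactness

open Real MeasureTheory Filter Set Topology intervalIntegral

variable {X : Type*} [MeasurableSpace X] {μ : Measure X} {w q : X → ℝ}

variable [SFinite μ]

omit [SFinite μ] in
/-- `0 ≤ P̃(v) ≤ ∫ q`. -/
theorem qMassLe_bounds (hwm : Measurable w) (hq0 : ∀ t, 0 < q t) (hqm : Measurable q)
    (hqi : Integrable q μ) (v : ℝ) : 0 ≤ qMassLe μ w q v ∧ qMassLe μ w q v ≤ ∫ z, q z ∂μ := by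
  obtain ⟨hi, h0, h1⟩ := integrable_qMassLe_integrand hwm hq0 hqm hqi v
  unfold qMassLe
  exact ⟨integral_nonneg h0, integral_mono hi hqi h1⟩

/-! ## Continuity and the right derivative -/

omit [SFinite μ] in
/-- **`λ` is continuous on `(0, ∞)`** (dominated convergence). -/
theorem continuousAt_rejCurve (hw0 : ∀ t, 0 < w t) (hwm : Measurable w) (hq0 : ∀ t, 0 < q t)
    (hqm : Measurable q) (hqi : Integrable q μ) {u : ℝ} (hu : 0 < u) :
    ContinuousAt (rejCurve μ w q) u := by
  unfold rejCurve
  refine continuousAt_of_dominated (bound := q) ?_ ?_ hqi ?_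
  · exact Eventually.of_forall fun v => (measurable_rejCurve_integrand hwm hqm v).aestronglyMeasurable
  · filter_upwards [Ioi_mem_nhds hu] with v hv
    refine Eventually.of_forall fun z => ?_
    obtain ⟨h0, h1⟩ := rejCurve_integrand_bounds hw0 hq0 hv z
    rw [Real.norm_eq_abs, abs_of_nonneg h0]
    exact h1
  · refine Eventually.of_forall fun z => ?_
    have h1 : Tendsto (fun v : ℝ => w z / q z / v) (𝓝 u) (𝓝 (w z / q z / u)) :=
      tendsto_const_nhds.div tendsto_id hu.ne'
    exact ((tendsto_const_nhds (x := (1:ℝ))).sub ((tendsto_const_nhds (x := (1:ℝ))).min h1)).mul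
      (tendsto_const_nhds (x := q z))

omit [SFinite μ] in
/-- `λ` is continuous on every `[c, a] ⊂ (0, ∞)`. -/
theorem continuousOn_rejCurve (hw0 : ∀ t, 0 < w t) (hwm : Measurable w) (hq0 : ∀ t, 0 < q t)
    (hqm : Measurable q) (hqi : Integrable q μ) {c a : ℝ} (hc : 0 < c) :
    ContinuousOn (rejCurve μ w q) (Icc c a) := fun _ hu =>
  (continuousAt_rejCurve hw0 hwm hq0 hqm hqi (hc.trans_le hu.1)).continuousWithinAt

omit [SFinite μ] in
/-- **Right limit of the strict mass**: `Π(t⁻) → Π(u)` as `t ↓ u` (dominated convergence). -/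
theorem tendsto_massBelow_right (hw0 : ∀ t, 0 < w t) (hwm : Measurable w) (hwi : Integrable w μ)
    (hqm : Measurable q) (u : ℝ) :
    Tendsto (massBelow μ w q) (𝓝[>] u) (𝓝 (massLe μ w q u)) := by
  unfold massBelow massLe
  refine tendsto_integral_filter_of_dominated_convergence (bound := w) ?_ ?_ hwi ?_
  · exact Eventually.of_forall fun t =>
      (measurable_massBelow_integrand hwm hqm t).aestronglyMeasurable
  · refine Eventually.of_forall fun t => Eventually.of_forall fun z => ?_
    obtain ⟨h0, h1, h2⟩ := mass_integrand_bounds (q := q) hw0 t z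
    rw [Real.norm_eq_abs, abs_of_nonneg h0]
    exact h1.trans h2
  · refine Eventually.of_forall fun z => ?_
    by_cases h : w z / q z ≤ u
    · rw [if_pos h]
      apply tendsto_const_nhds.congr'
      filter_upwards [self_mem_nhdsWithin] with t ht
      rw [if_pos (h.trans_lt ht)]
    · rw [if_neg h]
      have hlt : u < w z / q z := not_le.1 h
      apply tendsto_const_nhds.congr'
      have hev : ∀ᶠ t in 𝓝[>] u, t < w z / q z := mem_nhdsWithin_of_mem_nhds (Iio_mem_nhds hlt)
      filter_upwards [hev] with t ht
      rw [if_neg (not_lt.2 ht.le)]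

omit [SFinite μ] in
/-- `massBelow / u²` is interval-integrable on `[c, a] ⊂ (0, ∞)` (bounded by `Z/c²`). -/
theorem intervalIntegrable_massBelow_div (hw0 : ∀ t, 0 < w t) (hwm : Measurable w)
    (hwi : Integrable w μ) (hqm : Measurable q) {c a : ℝ} (hc : 0 < c) (hca : c ≤ a) :
    IntervalIntegrable (fun x => massBelow μ w q x / x ^ 2) volume c a := by
  have hm : Measurable (massBelow μ w q) := (massBelow_mono hw0 hwm hwi hqm).measurable
  refine (intervalIntegrable_const (c := (∫ z, w z ∂μ) / c ^ 2)).mono_fun'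
    (hm.div (measurable_id.pow_const 2)).aestronglyMeasurable ?_
  refine (ae_restrict_iff' measurableSet_uIoc).2 (Eventually.of_forall fun x hx => ?_)
  dsimp only
  rw [uIoc_of_le hca] at hx
  obtain ⟨h0, h1, h2⟩ := massBelow_bounds hw0 hwm hwi hqm x
  have hcp : c ^ 2 ≤ x ^ 2 := pow_le_pow_left₀ hc.le hx.1.le 2
  rw [Real.norm_eq_abs, abs_of_nonneg (div_nonneg h0 (sq_nonneg _))]
  calc massBelow μ w q x / x ^ 2 ≤ massBelow μ w q x / c ^ 2 :=
        div_le_div_of_nonneg_left h0 (pow_pos hc 2) hcp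
    _ ≤ (∫ z, w z ∂μ) / c ^ 2 := div_le_div_of_nonneg_right (h1.trans h2) (pow_pos hc 2).le

/-- **RIGHT DERIVATIVE OF THE REJECTION CURVE**: for every `u > 0`,
`λ'(u⁺) = Π(u)/u²`, `Π(u) = ∫ 1[b ≤ u] w dμ` — at atoms of the weight law `λ` has a corner, but the
right derivative always exists. -/
theorem hasDerivWithinAt_rejCurve (hw0 : ∀ t, 0 < w t) (hwm : Measurable w) (hwi : Integrable w μ)
    (hq0 : ∀ t, 0 < q t) (hqm : Measurable q) (hqi : Integrable q μ) {u : ℝ} (hu : 0 < u) :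
    HasDerivWithinAt (rejCurve μ w q) (massLe μ w q u / u ^ 2) (Ioi u) u := by
  set c := u / 2 with hc_def
  have hc : 0 < c := by rw [hc_def]; linarith
  have hcu : c < u := by rw [hc_def]; linarith
  have hrep : ∀ t, c ≤ t →
      rejCurve μ w q c + ∫ x in c..t, massBelow μ w q x / x ^ 2 = rejCurve μ w q t := by
    intro t ht
    rw [← rejCurve_sub_eq hw0 hwm hwi hq0 hqm hqi hc ht]
    ring
  have hm : Measurable (massBelow μ w q) := (massBelow_mono hw0 hwm hwi hqm).measurable
  have hfm : Measurable fun x => massBelow μ w q x / x ^ 2 := hm.div (measurable_id.pow_const 2)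
  have hderiv_int : HasDerivWithinAt (fun t => ∫ x in c..t, massBelow μ w q x / x ^ 2)
      (massLe μ w q u / u ^ 2) (Ici u) u := by
    refine intervalIntegral.integral_hasDerivWithinAt_of_tendsto_ae_right
      (intervalIntegrable_massBelow_div hw0 hwm hwi hqm hc hcu.le)
      hfm.stronglyMeasurable.stronglyMeasurableAtFilter ?_
    refine Tendsto.mono_left ?_ inf_le_left
    have h1 := tendsto_massBelow_right hw0 hwm hwi hqm u (q := q)
    have h2 : Tendsto (fun x : ℝ => x ^ 2) (𝓝[>] u) (𝓝 (u ^ 2)) :=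
      ((continuous_pow 2).tendsto u).mono_left nhdsWithin_le_nhds
    exact h1.div h2 (pow_ne_zero 2 hu.ne')
  have h3 : HasDerivWithinAt (fun t => rejCurve μ w q c + ∫ x in c..t, massBelow μ w q x / x ^ 2)
      (massLe μ w q u / u ^ 2) (Ioi u) u :=
    (hderiv_int.const_add _).mono Ioi_subset_Ici_self
  refine h3.congr_of_eventuallyEq ?_ (hrep u hcu.le).symm
  filter_upwards [self_mem_nhdsWithin] with t ht
  exact (hrep t (hcu.trans ht).le).symm

/-- Right derivative of `λ^{n+1}`: `(n+1) λ(u)ⁿ Π(u)/u²`. -/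
theorem hasDerivWithinAt_rejCurve_pow (hw0 : ∀ t, 0 < w t) (hwm : Measurable w)
    (hwi : Integrable w μ) (hq0 : ∀ t, 0 < q t) (hqm : Measurable q) (hqi : Integrable q μ)
    {u : ℝ} (hu : 0 < u) (n : ℕ) :
    HasDerivWithinAt (fun t => rejCurve μ w q t ^ (n + 1))
      ((n + 1 : ℝ) * rejCurve μ w q u ^ n * (massLe μ w q u / u ^ 2)) (Ioi u) u := by
  have h := (hasDerivWithinAt_rejCurve hw0 hwm hwi hq0 hqm hqi hu).pow (n + 1)
  simp only [Nat.add_sub_cancel, Nat.cast_add, Nat.cast_one] at h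
  exact h

/-- Right derivative of `λ^{n+1}/u`: `(n+1) λⁿ Π(u)/u³ − λ^{n+1}/u²`. -/
theorem hasDerivWithinAt_rejCurve_pow_div (hw0 : ∀ t, 0 < w t) (hwm : Measurable w)
    (hwi : Integrable w μ) (hq0 : ∀ t, 0 < q t) (hqm : Measurable q) (hqi : Integrable q μ)
    {u : ℝ} (hu : 0 < u) (n : ℕ) :
    HasDerivWithinAt (fun t => rejCurve μ w q t ^ (n + 1) / t)
      (((n + 1 : ℝ) * rejCurve μ w q u ^ n * (massLe μ w q u / u ^ 2)) * u⁻¹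
        + rejCurve μ w q u ^ (n + 1) * (-(u ^ 2)⁻¹)) (Ioi u) u := by
  have h1 := hasDerivWithinAt_rejCurve_pow hw0 hwm hwi hq0 hqm hqi hu n
  have h2 : HasDerivWithinAt (fun t : ℝ => t⁻¹) (-(u ^ 2)⁻¹) (Ioi u) u :=
    (hasDerivAt_inv hu.ne').hasDerivWithinAt
  have h := h1.mul h2
  simp only [div_eq_mul_inv] at h ⊢
  exact h

end Summit.Ventures.LatticeQCDFlow.Exactness
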